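import Summits.PneNP.PneNP.Theorems.SoloInformedQuantifierShape
import Summits.PneNP.PneNP.Theorems.SoloBlindAnchor
import Literature.Computability.MetaComplexity.InstanceComplexityHardSets
import HarnessLib

/-!
# The arithmetized `Π₂` form of `PneNP`, its finite levels, and the approximation rate of `SAT` by `P`

Soloist file (`solo-PneNP-informed`; landing prefix `SoloInformed`). A kernel-checked SHARPENING of
the summit statement for the provability / independence discussion (Hartmanis–Hopcroft 1976;
Kurtz–O'Donnell–Royer 1987; Ben-David–Halevi 1991/92; Carmosino–Kabanets–Kolokolova–Oliveira 2021,
§5.1). No progress toward the summit is claimed and no logic is formalized: only the normal form of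
the statement to which the proof-theoretic results apply.

Fix the tree's efficient universal machine `stdU` (`ClockedUniversalRun.lean`). A CLOCKED PROGRAM is
a pair `(π, a)`: program `π` run by `stdU` on input `x` (i.e. on `boolPair π x`) for `|x|^a + a`
steps; its ERROR SET on `SAT` is `SoloRate.errSet π a = {x | output ≠ [SAT.boolIndicator x]}`.

* Clocked programs are exactly `P`: each accepts a language in `P` (`soloInformed_progLang_mem_P`,
  the field `UniversalMachine.polyTime` through `codeFP_encOpt_run`), and every `L ∈ P` is decided
  on every input by one (`soloInformed_exists_clockedProgram_of_mem_P`, from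
  `exists_consistent_decider_of_mem_P`). Hence the summit is the `∀∃` sentence over strings and
  numbers with a decidable matrix (one bounded run of `stdU`):
  `PneNP ↔ ∀ π a, (errSet π a).Nonempty` (`soloInformed_pneNP_iff_every_program_errs`) — the
  `Π₂` sentence of the independence literature — and, lengthwise infinitely often,
  `PneNP ↔ ∀ π a n, ∃ x ∈ errSet π a, n ≤ |x|` (`soloInformed_pneNP_iff_every_program_errs_io`).
* FINITE LEVELS. `SoloRate.levelBounds k = {N | every clocked program with |π| ≤ k, a ≤ k errs on an
  input of length ≤ N}` (membership is a bounded statement). Then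
  `PneNP ↔ ∀ k, (levelBounds k).Nonempty` (`soloInformed_pneNP_iff_forall_levelBounds_nonempty`)
  and `PneNP ↔ ∃ f : ℕ → ℕ, ∀ k, f k ∈ levelBounds k` (`soloInformed_pneNP_iff_exists_rate_bound`):
  the least element `SoloRate.rate k = sInf (levelBounds k)` is Ben-David–Halevi's APPROXIMATION RATE
  of `SAT` by `P`, every explicit bound `f` yields a `Π₁` statement implying the summit
  (`soloInformed_pneNP_of_rate_bound`), and which `f` a proof can supply is what its logical strength
  is measured by (their theorem: `PA + TrueΠ₁ ⊢ P ≠ NP` iff some `F_α`, `α < ε₀`, is such an `f`).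
* `N ∉ levelBounds k` iff ONE clocked program of level `≤ k` is correct on ALL inputs of length `≤ N`
  (`soloInformed_not_mem_levelBounds_iff`); unconditionally every `N` lies outside some level
  (`soloInformed_exists_level_not_mem_levelBounds`, table look-up), so under `PneNP` the rate is
  monotone and unbounded (`soloInformed_rate_mono`, `soloInformed_rate_unbounded`): all the content
  of the summit is that the rate is DEFINED at every level.

References: J. Hartmanis, J. Hopcroft, SIGACT News 8(4) (1976) 13–24; S. Kurtz, M. O'Donnell,
J. Royer, Inf. Process. Lett. 24 (1987) 5–10; S. Ben-David, S. Halevi, *On the independence of P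
versus NP*, Technion CS TR 699 (1991) / TR 714 (1992); M. Carmosino, V. Kabanets, A. Kolokolova,
I. C. Oliveira, FOCS 2021, §5.1 eq. (4); S. Arora, B. Barak (2009), Thm 1.9, Def. 1.13, Thm 2.8,
Thm 2.10. The face `PneNP ↔ SAT ∉ P` is reused from the landed `SoloBlindAnchor` module (gate dedup).
Standard axioms only.
-/

namespace Summit.PneNP.PneNP.Theorems

open Literature.Computability.Complexity Literature.Computability.MetaComplexity
open Literature.Computability.Complexity.CodeFP Polynomial

/-- The ERROR SET on `SAT` of the clocked program `(π, a)`: the inputs `x` on which `stdU`, run on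
`boolPair π x` for `|x|^a + a` steps, does not output `[SAT.boolIndicator x]` (membership is decided
by one bounded run of the fixed universal machine). [Ben-David–Halevi 1992, §2; Arora–Barak 2009,
Thm 1.9] -/
def SoloRate.errSet (π : List Bool) (a : ℕ) : Set (List Bool) :=
  {x : List Bool | stdU.run (boolPair π x) (x.length ^ a + a) ≠ some [SAT.boolIndicator x]}

/-- The language ACCEPTED by the clocked program `(π, a)`: the inputs on which the clocked run
outputs `[true]`. [Arora–Barak 2009, Def. 1.13] -/
def SoloRate.progLang (π : List Bool) (a : ℕ) : Language Bool :=
  {x : List Bool | stdU.run (boolPair π x) (x.length ^ a + a) = some [true]}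

/-- The admissible bounds at LEVEL `k`: the numbers `N` such that every clocked program of level
`≤ k` (`|π| ≤ k` and `a ≤ k`) errs on `SAT` on some input of length `≤ N` (an upper set; all
quantifiers bounded). Its least element is the approximation rate of `SAT` by `P` at `k`.
[Ben-David–Halevi 1992, Def. of the approximation rate `R_L^C`] -/
def SoloRate.levelBounds (k : ℕ) : Set ℕ :=
  {N : ℕ | ∀ π : List Bool, π.length ≤ k → ∀ a : ℕ, a ≤ k →
    ∃ x ∈ SoloRate.errSet π a, x.length ≤ N}

/-- The APPROXIMATION RATE of `SAT` by `P` at level `k`: the least admissible bound (`sInf`, junk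
value `0` at a level with no admissible bound, i.e. when `PneNP` fails from that level on).
[Ben-David–Halevi 1992, Def. of `R_L^C`] -/
noncomputable def SoloRate.rate (k : ℕ) : ℕ := sInf (SoloRate.levelBounds k)

/-- `x ∉ errSet π a` iff the clocked run outputs `SAT`'s answer on `x`. [folklore] -/
theorem SoloRate.not_mem_errSet_iff {π : List Bool} {a : ℕ} {x : List Bool} :
    x ∉ SoloRate.errSet π a ↔
      stdU.run (boolPair π x) (x.length ^ a + a) = some [SAT.boolIndicator x] := by
  change ¬ (stdU.run (boolPair π x) (x.length ^ a + a) ≠ some [SAT.boolIndicator x]) ↔ _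
  rw [not_not]

/-- If the clocked run of `(π, a)` on `x` outputs `[L.boolIndicator x]`, then `(π, a)` accepts `x`
iff `x ∈ L`. [Arora–Barak 2009, Def. 1.13] -/
theorem SoloRate.mem_progLang_iff_of_run {L : Language Bool} {π : List Bool} {a : ℕ} {x : List Bool}
    (h : stdU.run (boolPair π x) (x.length ^ a + a) = some [L.boolIndicator x]) :
    x ∈ SoloRate.progLang π a ↔ x ∈ L := by
  change stdU.run (boolPair π x) (x.length ^ a + a) = some [true] ↔ x ∈ L
  rw [h]
  constructor
  · intro hb
    have hb' : L.boolIndicator x = true := by simpa using hb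
    exact (Set.mem_iff_boolIndicator _ _).2 hb'
  · intro hx
    rw [(Set.mem_iff_boolIndicator _ _).1 hx]

open SoloRate

/-! ### Clocked programs = `P` -/

/-- **Every clocked program accepts a language in `P`.** The decider computes
`encOpt (stdU.run (boolPair π x) (|x|^a + a))` (`codeFP_encOpt_run`, i.e. the field
`UniversalMachine.polyTime`) and compares it with `encOpt (some [true]) = [true, true]`.
[Arora–Barak 2009, Thm 1.9 and Def. 1.13] -/
theorem soloInformed_progLang_mem_P (π : List Bool) (a : ℕ) : progLang π a ∈ Classes.P := by
  classical
  obtain ⟨Dec, hDec⟩ : ∃ Dec : List Bool → Bool, Dec = fun x =>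
      decide (Literature.Computability.Cryptography.encOpt
        (stdU.run (boolPair π x) (x.length ^ a + a)) = [true, true]) := ⟨_, rfl⟩
  have hDec_iff : ∀ x, Dec x = true ↔ x ∈ progLang π a := by
    intro x
    rw [hDec]
    simp only [decide_eq_true_eq]
    change _ ↔ stdU.run (boolPair π x) (x.length ^ a + a) = some [true]
    cases hrun : stdU.run (boolPair π x) (x.length ^ a + a) with
    | none => simp
    | some y => simp
  have hDecC : CodeFP strE bitE Dec := by
    have hpolyU : ∀ P : Polynomial ℕ, CodeFP unE unE (fun n => P.eval n) := fun P =>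
      ⟨Plumb.polyFn P, Plumb.polyFn_mem_FP P, fun n => by
        rw [Plumb.polyFn_apply, length_unE, unE_eq_ones]⟩
    have hstrEq : CodeFP (pairE strE strE) bitE (fun q => decide (q.1 = q.2)) :=
      CodeFP.eq (fun _ _ h => h)
    have hprog : CodeFP strE strE (fun x => boolPair π x) :=
      (((CodeFP.const strE (eβ := strE) π).pair (CodeFP.id strE)).recodeOut fun _ => rfl :)
    have hbud : CodeFP strE unE (fun x : List Bool => x.length ^ a + a) :=
      ((hpolyU (X ^ a + C a)).comp strLength).congr fun x => by simp
    have hrun : CodeFP strE strE (fun x => Literature.Computability.Cryptography.encOpt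
        (stdU.run (boolPair π x) (x.length ^ a + a))) :=
      ((codeFP_encOpt_run stdU).comp (hprog.pair hbud) :)
    rw [hDec]
    exact (hstrEq.comp (hrun.pair (CodeFP.const strE [true, true])) :)
  obtain ⟨dFn, hd, hdx⟩ := hDecC
  refine mem_P_of_mem_FP hd _ fun x => ⟨fun hx => ?_, fun hx => ?_⟩
  · have := hdx x
    rw [(hDec_iff x).2 hx] at this
    exact this
  · have := hdx x
    cases hDx : Dec x with
    | true => exact absurd ((hDec_iff x).1 hDx) hx
    | false => rw [hDx] at this; exact this

/-- **A clocked program correct everywhere puts its language in `P`.** If `stdU` run on `boolPair π x`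
for `|x|^a + a` steps outputs `[L.boolIndicator x]` for every `x`, then `L ∈ P` (it is the language
accepted by `(π, a)`). [Arora–Barak 2009, Def. 1.13] -/
theorem soloInformed_mem_P_of_clockedProgram {L : Language Bool} (π : List Bool) (a : ℕ)
    (h : ∀ x : List Bool, stdU.run (boolPair π x) (x.length ^ a + a) = some [L.boolIndicator x]) :
    L ∈ Classes.P := by
  have hL : L = progLang π a := by
    ext x
    exact (mem_progLang_iff_of_run (h x)).symm
  rw [hL]
  exact soloInformed_progLang_mem_P π a

/-- **Every language in `P` is decided everywhere by a clocked program** (completeness of `stdU` with a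
polynomial clock: `exists_consistent_decider_of_mem_P`). [Orponen–Ko–Schöning–Watanabe 1994, §2;
Arora–Barak 2009, Thm 1.9] -/
theorem soloInformed_exists_clockedProgram_of_mem_P {L : Language Bool} (hL : L ∈ Classes.P) :
    ∃ (π : List Bool) (a : ℕ), ∀ x : List Bool,
      stdU.run (boolPair π x) (x.length ^ a + a) = some [L.boolIndicator x] := by
  obtain ⟨π, a, hcons, htot⟩ := exists_consistent_decider_of_mem_P stdU hL
  refine ⟨π, a, fun x => ?_⟩
  obtain ⟨b, hb⟩ := htot x
  have hbx : b = true ↔ x ∈ L := hcons x _ b hb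
  rw [hb]
  by_cases hx : x ∈ L
  · rw [hbx.2 hx, (Set.mem_iff_boolIndicator _ _).1 hx]
  · have hb' : b = false := by
      cases b with
      | false => rfl
      | true => exact absurd (hbx.1 rfl) hx
    rw [hb', (Set.notMem_iff_boolIndicator _ _).1 hx]

/-- `SAT ∈ P ↔` some clocked program has EMPTY error set on `SAT`.
[Arora–Barak 2009, Thm 1.9, Def. 1.13] -/
theorem soloInformed_sat_mem_P_iff_exists_errSet_empty :
    SAT ∈ Classes.P ↔ ∃ (π : List Bool) (a : ℕ), errSet π a = ∅ := by
  constructor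
  · intro h
    obtain ⟨π, a, hπa⟩ := soloInformed_exists_clockedProgram_of_mem_P h
    exact ⟨π, a, Set.eq_empty_of_forall_notMem fun x => not_mem_errSet_iff.2 (hπa x)⟩
  · rintro ⟨π, a, h⟩
    exact soloInformed_mem_P_of_clockedProgram π a fun x =>
      not_mem_errSet_iff.1 (by rw [h]; exact Set.notMem_empty x)

/-! ### The `Π₂` sentence, its finite levels, the rate -/

/-- **The arithmetized `∀∃` form of the summit.** `PneNP ↔` every clocked program `(π, a)` of the
fixed universal machine has a NONEMPTY error set on `SAT` — a `Π₂` sentence over strings and numbers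
whose matrix is one bounded run of `stdU`. [Hartmanis–Hopcroft 1976, §2; Ben-David–Halevi 1992, §2;
Carmosino–Kabanets–Kolokolova–Oliveira 2021, §5.1 eq. (4)] -/
theorem soloInformed_pneNP_iff_every_program_errs :
    PneNP ↔ ∀ (π : List Bool) (a : ℕ), (errSet π a).Nonempty := by
  rw [SoloBlind.pneNP_iff_SAT_not_mem_P, soloInformed_sat_mem_P_iff_exists_errSet_empty]
  simp only [not_exists, ← Set.nonempty_iff_ne_empty]

/-- Admissible bounds form an upper set. [Ben-David–Halevi 1992, §2] -/
theorem soloInformed_levelBounds_upper {k N N' : ℕ} (h : N ∈ levelBounds k) (hN : N ≤ N') :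
    N' ∈ levelBounds k := fun π hπ a ha =>
  let ⟨x, hx, hxN⟩ := h π hπ a ha
  ⟨x, hx, hxN.trans hN⟩

/-- Admissible bounds decrease with the level. [Ben-David–Halevi 1992, §2] -/
theorem soloInformed_levelBounds_anti {k k' : ℕ} (hk : k ≤ k') : levelBounds k' ⊆ levelBounds k :=
  fun _ h π hπ a ha => h π (hπ.trans hk) a (ha.trans hk)

/-- **The summit is the totality of the approximation rate.** `PneNP ↔ ∀ k, (levelBounds k).Nonempty`:
for every level some finite length below which all level-`≤ k` clocked programs err (there are
finitely many programs per level, so their errors have a common length bound); conversely the clocked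
program `(π, a)` sits at level `max |π| a`.
[Ben-David–Halevi 1992, §2 ("`R_L^C` is total iff `L ∉ C`"); Kurtz–O'Donnell–Royer 1987] -/
theorem soloInformed_pneNP_iff_forall_levelBounds_nonempty :
    PneNP ↔ ∀ k : ℕ, (levelBounds k).Nonempty := by
  classical
  rw [soloInformed_pneNP_iff_every_program_errs]
  constructor
  · intro h k
    -- the finitely many clocked programs of level `≤ k`
    set S : Set (List Bool × ℕ) := {p | p.1.length ≤ k ∧ p.2 ≤ k} with hS
    have hSfin : S.Finite := by
      refine ((List.finite_length_le Bool k).prod (Set.finite_le_nat k)).subset ?_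
      rintro ⟨π, a⟩ ⟨hπ, ha⟩
      exact ⟨hπ, ha⟩
    choose f hf using fun p : List Bool × ℕ => h p.1 p.2
    refine ⟨hSfin.toFinset.sup fun p => (f p).length, fun π hπ a ha => ⟨f (π, a), hf (π, a), ?_⟩⟩
    have hp : (π, a) ∈ hSfin.toFinset := hSfin.mem_toFinset.2 ⟨hπ, ha⟩
    exact Finset.le_sup (f := fun p => (f p).length) hp
  · intro h π a
    obtain ⟨N, hN⟩ := h (max π.length a)
    obtain ⟨x, hx, -⟩ := hN π (le_max_left _ _) a (le_max_right _ _)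
    exact ⟨x, hx⟩

/-- **`Π₁` approximants of the summit.** Any explicit bound `f` on the approximation rate —
`∀ k, f k ∈ levelBounds k`, a sentence all of whose quantifiers after `∀ k` are bounded — implies
`PneNP`. (Ben-David–Halevi: `PA + TrueΠ₁` proves `P ≠ NP` iff such an `f` exists below some
`F_α`, `α < ε₀`; only this implication is formalized.) [Ben-David–Halevi 1992, Thm (PA₁);
Aaronson 2003 survey, §5] -/
theorem soloInformed_pneNP_of_rate_bound (f : ℕ → ℕ) (h : ∀ k : ℕ, f k ∈ levelBounds k) : PneNP :=
  soloInformed_pneNP_iff_forall_levelBounds_nonempty.2 fun k => ⟨f k, h k⟩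

/-- `PneNP ↔ ∃ f : ℕ → ℕ, ∀ k, f k ∈ levelBounds k` — the summit is the existence of SOME total bound
on the approximation rate; which `f` (how fast the rate may grow) is exactly what a proof in a given
theory supplies. [Ben-David–Halevi 1992, §2–3] -/
theorem soloInformed_pneNP_iff_exists_rate_bound :
    PneNP ↔ ∃ f : ℕ → ℕ, ∀ k : ℕ, f k ∈ levelBounds k := by
  rw [soloInformed_pneNP_iff_forall_levelBounds_nonempty]
  constructor
  · intro h
    choose f hf using h
    exact ⟨f, hf⟩
  · rintro ⟨f, hf⟩ k
    exact ⟨f k, hf k⟩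

/-- **A bound fails at a level iff ONE short clocked program is correct on ALL short inputs**
("`SAT` is easy, by a level-`≤ k` program, on every input of length `≤ N`").
[Ben-David–Halevi 1992, §3 (almost-polynomial algorithms on long initial segments)] -/
theorem soloInformed_not_mem_levelBounds_iff (k N : ℕ) :
    N ∉ levelBounds k ↔ ∃ π : List Bool, π.length ≤ k ∧ ∃ a : ℕ, a ≤ k ∧
      ∀ x : List Bool, x.length ≤ N → x ∉ errSet π a := by
  change (¬ ∀ π : List Bool, π.length ≤ k → ∀ a : ℕ, a ≤ k → ∃ x ∈ errSet π a, x.length ≤ N) ↔ _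
  push Not
  refine exists_congr fun π => and_congr_right fun _ => exists_congr fun a =>
    and_congr_right fun _ => ?_
  exact ⟨fun h x hx he => absurd (h x he) (not_lt.2 hx), fun h x he => not_le.1 fun hx => h x hx he⟩

/-- **Unconditionally, every bound fails at some level**: for every `N` some level has a clocked
program correct on all inputs of length `≤ N` (the finite language `SAT ∩ {x | |x| ≤ N}` is in `P`,
hence decided everywhere by a clocked program, which is then correct for `SAT` on the short inputs).
So all the content of the summit is that EVERY level has some admissible bound.
[Ben-David–Halevi 1992, §2] -/
theorem soloInformed_exists_level_not_mem_levelBounds (N : ℕ) : ∃ k : ℕ, N ∉ levelBounds k := by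
  classical
  set L : Language Bool := {x : List Bool | x ∈ SAT ∧ x.length ≤ N} with hLdef
  have hLfin : (L : Set (List Bool)).Finite :=
    (List.finite_length_le Bool N).subset fun x hx => hx.2
  have hLP : L ∈ Classes.P := Literature.Barriers.PneNP.mem_P_of_finite hLfin
  obtain ⟨π, a, hπa⟩ := soloInformed_exists_clockedProgram_of_mem_P hLP
  refine ⟨max π.length a, (soloInformed_not_mem_levelBounds_iff _ _).2
    ⟨π, le_max_left _ _, a, le_max_right _ _, fun x hx => not_mem_errSet_iff.2 ?_⟩⟩
  have hind : L.boolIndicator x = SAT.boolIndicator x := by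
    by_cases hxS : x ∈ SAT
    · have hxL : x ∈ L := ⟨hxS, hx⟩
      rw [(Set.mem_iff_boolIndicator _ _).1 hxL, (Set.mem_iff_boolIndicator _ _).1 hxS]
    · have hxL : x ∉ L := fun h => hxS h.1
      rw [(Set.notMem_iff_boolIndicator _ _).1 hxL, (Set.notMem_iff_boolIndicator _ _).1 hxS]
  rw [hπa x, hind]

/-- Under `PneNP` the rate at every level is an admissible bound (the least one). [Ben-David–Halevi 1992, §2] -/
theorem soloInformed_rate_mem_levelBounds (h : PneNP) (k : ℕ) : rate k ∈ levelBounds k :=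
  Nat.sInf_mem (soloInformed_pneNP_iff_forall_levelBounds_nonempty.1 h k)

/-- The rate is below every admissible bound. [Ben-David–Halevi 1992, §2] -/
theorem soloInformed_rate_le {k N : ℕ} (hN : N ∈ levelBounds k) : rate k ≤ N := Nat.sInf_le hN

/-- Under `PneNP` the rate is monotone in the level. [Ben-David–Halevi 1992, §2] -/
theorem soloInformed_rate_mono (h : PneNP) {k k' : ℕ} (hk : k ≤ k') : rate k ≤ rate k' :=
  soloInformed_rate_le (soloInformed_levelBounds_anti hk (soloInformed_rate_mem_levelBounds h k'))

/-- Under `PneNP` the rate is unbounded: every `N` is exceeded at some level (and, by monotonicity,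
at all later ones). [Ben-David–Halevi 1992, §2 ("the faster `R` grows, the closer `L` is to `C`")] -/
theorem soloInformed_rate_unbounded (h : PneNP) (N : ℕ) : ∃ k : ℕ, N < rate k := by
  obtain ⟨k, hk⟩ := soloInformed_exists_level_not_mem_levelBounds N
  refine ⟨k, not_le.1 fun hle => hk ?_⟩
  exact soloInformed_levelBounds_upper (soloInformed_rate_mem_levelBounds h k) hle

/-- **The lengthwise infinitely-often form.** `PneNP ↔` every clocked program errs on `SAT` on inputs
of unbounded length (if `(π, a)` were correct on all inputs of length `≥ n`, `SAT` would differ from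
the language accepted by `(π, a)` — which is in `P` — on finitely many inputs, so `SAT ∈ P` by
closure of `P` under finite variation). [Arora–Barak 2009, Thm 2.8; Ben-David–Halevi 1992, §2] -/
theorem soloInformed_pneNP_iff_every_program_errs_io :
    PneNP ↔ ∀ (π : List Bool) (a n : ℕ), ∃ x ∈ errSet π a, n ≤ x.length := by
  constructor
  · intro h π a n
    by_contra hno
    push Not at hno
    -- `(π, a)` is correct on every input of length `≥ n`
    have hfin : ({x : List Bool | x ∈ SAT ↔ x ∉ progLang π a} : Set (List Bool)).Finite := by
      refine (List.finite_length_le Bool n).subset fun x hx => ?_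
      by_contra hxn
      have hxerr : x ∉ errSet π a := fun he => hxn (le_of_lt (hno x he))
      have hiff : x ∈ SAT ↔ x ∈ progLang π a :=
        (mem_progLang_iff_of_run (L := SAT) (not_mem_errSet_iff.1 hxerr)).symm
      exact iff_not_self (hiff.symm.trans hx)
    exact SoloBlind.pneNP_iff_SAT_not_mem_P.1 h
      (soloInformed_mem_P_of_finite_disagreement (soloInformed_progLang_mem_P π a) hfin)
  · intro h
    exact soloInformed_pneNP_iff_every_program_errs.2 fun π a =>
      let ⟨x, hx, _⟩ := h π a 0
      ⟨x, hx⟩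

end Summit.PneNP.PneNP.Theorems
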